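import Mathlib.Topology.UnitInterval
import Mathlib.Topology.Algebra.Order.Field
import HarnessLib

/-!
# Unfolding a square onto two adjacent edges (a homotopy of the square through maps of pairs)

Topic `Literature/AlgebraicTopology/Homotopy`. An explicit one-parameter family of self-maps
`unfold λ : I × I → I × I` (`λ ∈ I = [0, 1]`) of the unit square, used to push one side face of a
cube into its lid in the proof of the cubical homotopy addition theorem
(`CubicalHomotopyAddition.lean`): writing points as `(s, u)`,

  `unfold λ (s, u) = (s · min(1, 2 - u(1 + λ)), (1 - s) u + s · min(u(1 + λ), 1))`,

i.e. the horizontal segment from `(0, u)` to `(1, u)` is mapped affinely onto the segment from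
`(0, u)` to the point `β_λ(u)` of the broken line "top edge `{s = 1}`, then down the edge
`{u = 1}`" at parameter `u(1 + λ)`. Properties (all proved, `[folklore]`):

* `unfold 0 = id`; `(λ, p) ↦ unfold λ p` is continuous;
* every `unfold λ` maps the boundary of the square into itself (`unfold_mem_sqBoundary`), fixes
  the edges `{s = 0}` and `{u = 0}` pointwise;
* at `λ = 1`: the edge `{u = 1}` is collapsed to the corner `(0, 1)`, and the edge `{s = 1}` is laid
  over the two edges `{s = 1} ∪ {u = 1}`: `unfold 1 (1, u) = (1, 2u)` for `u ≤ 1/2` and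
  `= (2 - 2u, 1)` for `u ≥ 1/2` (stated with `Set.projIcc`/`unitInterval.symm`, the form of
  Mathlib's `GenLoop.transAt`/`GenLoop.symmAt`);
* `unfold' λ` — the conjugate by `u ↦ 1 - u`, collapsing `{u = 0}` instead.

This is the planar geometry behind "the sum `f + g` in `πₙ` … deformations of the cube sliding a
face onto an adjacent one" (Hatcher, *Algebraic Topology* (2002), §4.1, pp. 340–341); no claim
of originality.

## References

* A. Hatcher, *Algebraic Topology*, CUP (2002), §4.1, pp. 340–341. [HatcherAT2002]
-/

noncomputable section

open unitInterval Set

namespace Literature.AlgebraicTopology.Homotopy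

namespace SquareUnfold

/-! ### The two coordinate functions -/

/-- First coordinate of `unfold λ (s, u)`: `s · min(1, 2 - u(1 + λ))`. [folklore] -/
def fstFun (l s u : ℝ) : ℝ := s * min 1 (2 - u * (1 + l))

/-- Second coordinate of `unfold λ (s, u)`: `(1 - s) u + s · min(u(1 + λ), 1)`. [folklore] -/
def sndFun (l s u : ℝ) : ℝ := (1 - s) * u + s * min (u * (1 + l)) 1

/-- `fstFun` is continuous on `I × (I × I)`. [folklore] -/
lemma continuous_fstFun :
    Continuous fun q : I × (I × I) => fstFun (q.1 : ℝ) (q.2.1 : ℝ) (q.2.2 : ℝ) := by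
  unfold fstFun
  fun_prop

/-- `sndFun` is continuous on `I × (I × I)`. [folklore] -/
lemma continuous_sndFun :
    Continuous fun q : I × (I × I) => sndFun (q.1 : ℝ) (q.2.1 : ℝ) (q.2.2 : ℝ) := by
  unfold sndFun
  fun_prop

variable {l s u : ℝ}

/-- The factor `min(1, 2 - u(1 + λ))` lies in `[0, 1]`. [folklore] -/
lemma min_one_mem (hl : l ∈ I) (hu : u ∈ I) : min 1 (2 - u * (1 + l)) ∈ I := by
  obtain ⟨hl0, hl1⟩ := hl; obtain ⟨hu0, hu1⟩ := hu
  refine ⟨le_min zero_le_one ?_, min_le_left _ _⟩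
  nlinarith

/-- The factor `min(u(1 + λ), 1)` lies in `[0, 1]`. [folklore] -/
lemma min_mul_mem (hl : l ∈ I) (hu : u ∈ I) : min (u * (1 + l)) 1 ∈ I := by
  obtain ⟨hl0, hl1⟩ := hl; obtain ⟨hu0, hu1⟩ := hu
  exact ⟨le_min (by nlinarith) zero_le_one, min_le_right _ _⟩

/-- `fstFun λ s u ∈ [0, 1]` on the cube. [folklore] -/
lemma fstFun_mem (hl : l ∈ I) (hs : s ∈ I) (hu : u ∈ I) : fstFun l s u ∈ I :=
  unitInterval.mul_mem hs (min_one_mem hl hu)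

/-- `sndFun λ s u ∈ [0, 1]` on the cube (a convex combination of `u` and a point of `[0, 1]`).
[folklore] -/
lemma sndFun_mem (hl : l ∈ I) (hs : s ∈ I) (hu : u ∈ I) : sndFun l s u ∈ I := by
  have hm := min_mul_mem hl hu
  obtain ⟨hs0, hs1⟩ := hs; obtain ⟨hu0, hu1⟩ := hu; obtain ⟨hm0, hm1⟩ := hm
  constructor
  · unfold sndFun; nlinarith
  · unfold sndFun; nlinarith

/-! ### The unfolding family -/

/-- **The unfolding map `unfold λ : I × I → I × I`**,
`(s, u) ↦ (s · min(1, 2 - u(1+λ)), (1 - s) u + s · min(u(1+λ), 1))`. [folklore] -/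
def unfold (l : I) (p : I × I) : I × I :=
  (⟨fstFun l p.1 p.2, fstFun_mem l.2 p.1.2 p.2.2⟩, ⟨sndFun l p.1 p.2, sndFun_mem l.2 p.1.2 p.2.2⟩)

/-- First coordinate of `unfold`. [folklore] -/
@[simp] lemma coe_unfold_fst (l : I) (p : I × I) : ((unfold l p).1 : ℝ) = fstFun l p.1 p.2 := rfl

/-- Second coordinate of `unfold`. [folklore] -/
@[simp] lemma coe_unfold_snd (l : I) (p : I × I) : ((unfold l p).2 : ℝ) = sndFun l p.1 p.2 := rfl

/-- **Joint continuity** of `(λ, p) ↦ unfold λ p`. [folklore] -/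
theorem continuous_unfold : Continuous fun q : I × (I × I) => unfold q.1 q.2 :=
  (continuous_fstFun.subtype_mk _).prodMk (continuous_sndFun.subtype_mk _)

/-- Continuity of `unfold λ` for fixed `λ`. [folklore] -/
lemma continuous_unfold_right (l : I) : Continuous (unfold l) :=
  continuous_unfold.comp (Continuous.prodMk continuous_const continuous_id)

/-- **`unfold 0 = id`.** [folklore] -/
@[simp] theorem unfold_zero (p : I × I) : unfold 0 p = p := by
  obtain ⟨⟨s, hs0, hs1⟩, ⟨u, hu0, hu1⟩⟩ := p
  refine Prod.ext (Subtype.ext ?_) (Subtype.ext ?_)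
  · change s * min 1 (2 - u * (1 + 0)) = s
    rw [min_eq_left (by linarith), mul_one]
  · change (1 - s) * u + s * min (u * (1 + 0)) 1 = u
    rw [min_eq_left (by linarith)]; ring

/-- **The edge `{s = 0}` is fixed pointwise** by every `unfold λ`. [folklore] -/
@[simp] theorem unfold_zero_left (l u : I) : unfold l (0, u) = (0, u) := by
  refine Prod.ext (Subtype.ext ?_) (Subtype.ext ?_)
  · change (0 : ℝ) * _ = 0; rw [zero_mul]
  · change (1 - 0) * (u : ℝ) + 0 * _ = u; ring

/-- **The edge `{u = 0}` is fixed pointwise** by every `unfold λ`. [folklore] -/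
@[simp] theorem unfold_zero_right (l s : I) : unfold l (s, 0) = (s, 0) := by
  obtain ⟨l, hl0, hl1⟩ := l
  refine Prod.ext (Subtype.ext ?_) (Subtype.ext ?_)
  · change (s : ℝ) * min 1 (2 - 0 * (1 + l)) = s
    rw [zero_mul, sub_zero, min_eq_left (by norm_num : (1 : ℝ) ≤ 2), mul_one]
  · change (1 - (s : ℝ)) * 0 + s * min (0 * (1 + l)) 1 = 0
    rw [zero_mul, min_eq_left zero_le_one]; ring

/-- The edge `{u = 1}` is mapped into itself: `unfold λ (s, 1) = (s (1 - λ), 1)`. [folklore] -/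
theorem unfold_one_right (l s : I) :
    unfold l (s, 1) = (⟨(s : ℝ) * (1 - l), unitInterval.mul_mem s.2 (σ l).2⟩, 1) := by
  obtain ⟨l, hl0, hl1⟩ := l
  refine Prod.ext (Subtype.ext ?_) (Subtype.ext ?_)
  · change (s : ℝ) * min 1 (2 - 1 * (1 + l)) = s * (1 - l)
    rw [one_mul, min_eq_right (by linarith)]; ring
  · change (1 - (s : ℝ)) * 1 + s * min (1 * (1 + l)) 1 = 1
    rw [one_mul, min_eq_right (by linarith)]; ring

/-- **At `λ = 1` the edge `{u = 1}` is collapsed to the corner `(0, 1)`.** [folklore] -/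
@[simp] theorem unfold_one_one_right (s : I) : unfold 1 (s, 1) = (0, 1) := by
  rw [unfold_one_right]
  refine Prod.ext (Subtype.ext ?_) rfl
  change (s : ℝ) * (1 - 1) = 0; ring

/-- The edge `{s = 1}` at `λ = 1`, first half: `unfold 1 (1, u) = (1, 2u)` for `u ≤ 1/2` (with
`2u` written `projIcc 0 1 (2u)` as in `GenLoop.transAt`). [folklore] -/
theorem unfold_one_left_of_le (u : I) (h : (u : ℝ) ≤ 1 / 2) :
    unfold 1 (1, u) = ((1 : I), Set.projIcc 0 1 zero_le_one (2 * (u : ℝ))) := by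
  obtain ⟨u, hu0, hu1⟩ := u
  change u ≤ 1 / 2 at h
  have hp : Set.projIcc 0 1 zero_le_one (2 * u) = ⟨2 * u, by constructor <;> linarith⟩ :=
    Set.projIcc_of_mem _ ⟨by linarith, by linarith⟩
  rw [hp]
  refine Prod.ext (Subtype.ext ?_) (Subtype.ext ?_)
  · change (1 : ℝ) * min 1 (2 - u * (1 + 1)) = 1
    rw [min_eq_left (by linarith), mul_one]
  · change (1 - 1) * u + 1 * min (u * (1 + 1)) 1 = 2 * u
    rw [min_eq_left (by linarith)]; ring

/-- The edge `{s = 1}` at `λ = 1`, second half: `unfold 1 (1, u) = (2 - 2u, 1)` for `u ≥ 1/2` (with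
`2 - 2u` written `σ (projIcc 0 1 (2u - 1))` as in `GenLoop.transAt`/`GenLoop.symmAt`). [folklore] -/
theorem unfold_one_left_of_ge (u : I) (h : 1 / 2 ≤ (u : ℝ)) :
    unfold 1 (1, u) = (σ (Set.projIcc 0 1 zero_le_one (2 * (u : ℝ) - 1)), (1 : I)) := by
  obtain ⟨u, hu0, hu1⟩ := u
  change 1 / 2 ≤ u at h
  have hp : Set.projIcc 0 1 zero_le_one (2 * u - 1) = ⟨2 * u - 1, by constructor <;> linarith⟩ :=
    Set.projIcc_of_mem _ ⟨by linarith, by linarith⟩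
  rw [hp]
  refine Prod.ext (Subtype.ext ?_) (Subtype.ext ?_)
  · change (1 : ℝ) * min 1 (2 - u * (1 + 1)) = 1 - (2 * u - 1)
    rw [min_eq_right (by linarith)]; ring
  · change (1 - 1) * u + 1 * min (u * (1 + 1)) 1 = 1
    rw [min_eq_right (by linarith)]; ring

/-- At `λ = 1` the corner `(1, 1)` goes to the corner `(0, 1)`. [folklore] -/
theorem unfold_one_one_one : unfold 1 (1, 1) = (0, 1) := unfold_one_one_right 1

/-! ### The boundary of the square is preserved -/

/-- The boundary of the unit square: some coordinate is `0` or `1`. [folklore] -/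
def sqBoundary : Set (I × I) := {p | p.1 = 0 ∨ p.1 = 1 ∨ p.2 = 0 ∨ p.2 = 1}

/-- Membership in `sqBoundary`. [folklore] -/
lemma mem_sqBoundary_iff (p : I × I) : p ∈ sqBoundary ↔ p.1 = 0 ∨ p.1 = 1 ∨ p.2 = 0 ∨ p.2 = 1 :=
  Iff.rfl

/-- The edge `{s = 1}` is mapped into `{s = 1} ∪ {u = 1}`. [folklore] -/
theorem unfold_one_left_mem (l u : I) : (unfold l (1, u)).1 = 1 ∨ (unfold l (1, u)).2 = 1 := by
  obtain ⟨l, hl0, hl1⟩ := l; obtain ⟨u, hu0, hu1⟩ := u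
  by_cases h : u * (1 + l) ≤ 1
  · left
    apply Subtype.ext
    change (1 : ℝ) * min 1 (2 - u * (1 + l)) = 1
    rw [min_eq_left (by linarith), mul_one]
  · right
    apply Subtype.ext
    change (1 - 1) * u + 1 * min (u * (1 + l)) 1 = 1
    rw [min_eq_right (by push Not at h; linarith)]; ring

/-- **Every `unfold λ` maps the boundary of the square into itself.** [folklore] -/
theorem unfold_mem_sqBoundary (l : I) {p : I × I} (hp : p ∈ sqBoundary) : unfold l p ∈ sqBoundary := by
  obtain ⟨s, u⟩ := p
  rcases hp with h | h | h | h <;> simp only at h <;> subst h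
  · rw [unfold_zero_left]; exact Or.inl rfl
  · rcases unfold_one_left_mem l u with h' | h'
    · exact Or.inr (Or.inl h')
    · exact Or.inr (Or.inr (Or.inr h'))
  · rw [unfold_zero_right]; exact Or.inr (Or.inr (Or.inl rfl))
  · rw [unfold_one_right]; exact Or.inr (Or.inr (Or.inr rfl))

/-! ### The conjugate family collapsing the edge `{u = 0}` -/

/-- Reflection of the second coordinate of the square, `(s, u) ↦ (s, 1 - u)`. [folklore] -/
def flipSnd (p : I × I) : I × I := (p.1, σ p.2)

/-- `flipSnd` is an involution. [folklore] -/
@[simp] lemma flipSnd_flipSnd (p : I × I) : flipSnd (flipSnd p) = p := by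
  simp [flipSnd]

/-- `flipSnd` is continuous. [folklore] -/
lemma continuous_flipSnd : Continuous flipSnd :=
  continuous_fst.prodMk (unitInterval.continuous_symm.comp continuous_snd)

/-- `flipSnd` preserves the boundary of the square. [folklore] -/
lemma flipSnd_mem_sqBoundary {p : I × I} (hp : p ∈ sqBoundary) : flipSnd p ∈ sqBoundary := by
  rcases hp with h | h | h | h
  · exact Or.inl h
  · exact Or.inr (Or.inl h)
  · exact Or.inr (Or.inr (Or.inr (by simp [flipSnd, h])))
  · exact Or.inr (Or.inr (Or.inl (by simp [flipSnd, h])))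

/-- **The conjugate unfolding `unfold' λ = flipSnd ∘ unfold λ ∘ flipSnd`**, collapsing the edge
`{u = 0}` at `λ = 1` and laying `{s = 1}` over `{u = 0} ∪ {s = 1}`. [folklore] -/
def unfold' (l : I) (p : I × I) : I × I := flipSnd (unfold l (flipSnd p))

/-- Joint continuity of `unfold'`. [folklore] -/
theorem continuous_unfold' : Continuous fun q : I × (I × I) => unfold' q.1 q.2 :=
  continuous_flipSnd.comp (continuous_unfold.comp
    (continuous_fst.prodMk (continuous_flipSnd.comp continuous_snd)))

/-- Continuity of `unfold' λ` for fixed `λ`. [folklore] -/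
lemma continuous_unfold'_right (l : I) : Continuous (unfold' l) :=
  continuous_unfold'.comp (Continuous.prodMk continuous_const continuous_id)

/-- `unfold' 0 = id`. [folklore] -/
@[simp] theorem unfold'_zero (p : I × I) : unfold' 0 p = p := by
  simp [unfold']

/-- `unfold' λ` fixes the edge `{s = 0}` pointwise. [folklore] -/
@[simp] theorem unfold'_zero_left (l u : I) : unfold' l (0, u) = (0, u) := by
  simp [unfold', flipSnd]

/-- `unfold' λ` fixes the edge `{u = 1}` pointwise. [folklore] -/
@[simp] theorem unfold'_one_right (l s : I) : unfold' l (s, 1) = (s, 1) := by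
  simp [unfold', flipSnd]

/-- At `λ = 1`, `unfold'` collapses the edge `{u = 0}` to the corner `(0, 0)`. [folklore] -/
@[simp] theorem unfold'_one_zero_right (s : I) : unfold' 1 (s, 0) = (0, 0) := by
  simp [unfold', flipSnd]

/-- The edge `{s = 1}` under `unfold' 1`, the half `u ≥ 1/2`: `unfold' 1 (1, u) = (1, 2u - 1)`.
[folklore] -/
theorem unfold'_one_left_of_ge (u : I) (h : 1 / 2 ≤ (u : ℝ)) :
    unfold' 1 (1, u) = ((1 : I), Set.projIcc 0 1 zero_le_one (2 * (u : ℝ) - 1)) := by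
  have h' : ((σ u : I) : ℝ) ≤ 1 / 2 := by rw [coe_symm_eq]; linarith
  change flipSnd (unfold 1 (1, σ u)) = _
  rw [unfold_one_left_of_le (σ u) h', flipSnd]
  refine Prod.ext rfl ?_
  change σ (Set.projIcc 0 1 zero_le_one (2 * ((σ u : I) : ℝ))) = _
  obtain ⟨u, hu0, hu1⟩ := u
  change 1 / 2 ≤ u at h
  apply Subtype.ext
  rw [coe_symm_eq, coe_symm_eq, Set.projIcc_of_mem _ ⟨by linarith, by linarith⟩,
    Set.projIcc_of_mem _ ⟨by linarith, by linarith⟩]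
  ring

/-- The edge `{s = 1}` under `unfold' 1`, the half `u ≤ 1/2`: `unfold' 1 (1, u) = (2u, 0)`.
[folklore] -/
theorem unfold'_one_left_of_le (u : I) (h : (u : ℝ) ≤ 1 / 2) :
    unfold' 1 (1, u) = (Set.projIcc 0 1 zero_le_one (2 * (u : ℝ)), (0 : I)) := by
  have h' : 1 / 2 ≤ ((σ u : I) : ℝ) := by rw [coe_symm_eq]; linarith
  change flipSnd (unfold 1 (1, σ u)) = _
  rw [unfold_one_left_of_ge (σ u) h', flipSnd]
  refine Prod.ext ?_ (by simp)
  change σ (Set.projIcc 0 1 zero_le_one (2 * ((σ u : I) : ℝ) - 1)) = _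
  obtain ⟨u, hu0, hu1⟩ := u
  change u ≤ 1 / 2 at h
  apply Subtype.ext
  rw [coe_symm_eq, coe_symm_eq, Set.projIcc_of_mem _ ⟨by linarith, by linarith⟩,
    Set.projIcc_of_mem _ ⟨by linarith, by linarith⟩]
  ring

/-- At `λ = 1`, `unfold'` sends the corner `(1, 0)` to the corner `(0, 0)`. [folklore] -/
theorem unfold'_one_one_zero : unfold' 1 (1, 0) = (0, 0) := unfold'_one_zero_right 1

/-- Every `unfold' λ` maps the boundary of the square into itself. [folklore] -/
theorem unfold'_mem_sqBoundary (l : I) {p : I × I} (hp : p ∈ sqBoundary) : unfold' l p ∈ sqBoundary :=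
  flipSnd_mem_sqBoundary (unfold_mem_sqBoundary l (flipSnd_mem_sqBoundary hp))

end SquareUnfold

end Literature.AlgebraicTopology.Homotopy

end
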